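import Literature.NumberTheory.EllipticCurves.TowerLimitPairingPerfectProofs
import HarnessLib

/-!
# A compatible family orthogonal to the saturated families is saturated — the annihilator half (ANN-SAT) of
# the rank-free (Exact) of Howard's H.4 for `F_𝔮` at `v ∣ p`, through a RESTRICTED pair tower (theorems only)

`Proofs` file (theorems only; no definition, no named fact, no instance, no notation, no `sorry`), in the currency
of the tree's abstract towers `Literature.NumberTheory.EllipticCurves.Tower.*` (`compatibleFamilies`,
`saturatedFamilies red p C`, `levelCondition red p C k` of `ZpExtensionEisensteinSelmerStructure`; `redIter` of
`TowerSaturatedCartesianProofs`), sequel of `TowerLimitPairingPerfectProofs` §3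
(`Tower.pow_smul_eq_zero_of_forall_pairing_eq_zero`: the right kernel of a limit pairing is torsion) and companion
of `TowerSaturatedAnnihilatorProofs` §3 (hypothesis (Exact) of `Tower.mem_levelCondition_of_forall_pairing_eq_zero`)
and `TowerSaturatedRepresentabilityProofs` (the representability half (e)).  Cell `pub/bsd-print-x9`, LEAD memo
`HOME/p1/H4-EXACT-AT-P-PLAN-x10b-p1-g8.md` §1 (a)–(d), brick (B6) split (ANN-SAT) / (EXACT-REP); shared μ-crux
`MuInequalityCoherentPairOfPrint` (stmt-BirchSwinnertonDyer-23237), STUB A field `SatisfiesH.h4` at `v ∣ p`.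

SETTING.  Two towers `(X_j, red)`, `(Y_j, red′)` with bi-additive level pairings `B_j : X_j × Y_j → Q_j` and cores
`C_j ≤ X_j`, `C′_j ≤ Y_j` (in the application `X_j = H¹(K_v, W_j)`, `Y_j = H¹(K_v, Tw W_j)`, `B_j` the induced local
pairing of Howard's H.4 datum, `C_j`/`C′_j` the STRICT ordinary cores `im H¹(K_v, Fil_v W_j)` and the transport of
`im H¹(K_σv, Fil_σv W_j)`), and a RESTRICTED PAIR of towers `(F_j, red_F)`, `(G_j, red_G)` with pairings
`P_j : F_j × G_j → Q_j` and tower maps `ι_j : F_j → X_j`, `π′_j : Y_j → G_j` (in the application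
`F_j = H¹(K_v, Fil_v W_j)`, `G_j = H¹(K_v, Tw W_j ⧸ Fil′)`, `P_j` the cup product of the restricted Weil–τ pairing
`Fil_v W_j × (Tw W_j ⧸ Fil′) → A_{m,j}(1)`), tied by the PROJECTION FORMULA `B_j (ι f, y) = P_j (f, π′ y)`
(cup-product naturality; well defined because `Fil ⊥ Fil′`), `ι_j (F_j) ⊆ C_j` and `ker π′_j ⊆ C′_j`.

* §1 bookkeeping: images of compatible families under tower maps are compatible; the image `ι ξ′` of a
  compatible family of `F` is SATURATED for the cores `C` (exponent `0`).
* §2 **`Tower.pow_smul_map_eq_zero_of_forall_saturated_pairing_eq_zero`**: if a family `ζ` of `Y` pairs to zero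
  with every saturated family of `X` at every level, then `p^c` kills `π′ ζ` — the right kernel of the limit of the
  restricted pairings is torsion (`Tower.pow_smul_eq_zero_of_forall_pairing_eq_zero` for the pair `(F, G, P)`, fed
  with (Adj′) / (Nondeg′) / (Ker′) for the pair and the exponent bound `p^c` of the torsion compatible families of
  `G`, in the application the uniform bound on `H⁰(K_v, gr′ W_d)`).
* §3 **`Tower.mem_saturatedFamilies_of_forall_saturated_pairing_eq_zero`** = (ANN-SAT): hence a COMPATIBLE such
  `ζ` is saturated for `C′` (`p^c ζ_j ∈ ker π′_j ⊆ C′_j`) — «`Ann_{Y∞}(Sat_X) ⊆ Sat_Y`», memo §1 (a)+(d), WITHOUT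
  ranks, `Module.Finite` or an Euler–Poincaré count; and the level-`k` corollary
  `Tower.mem_saturatedFamilies_of_forall_levelCondition_pairing_eq_zero` (orthogonality to the level conditions).

Nothing arithmetic is proved here; no summit statement is proved; BSD is not proved by any of this.

References: B. Howard, *The Heegner point Kolyvagin system*, Compositio Math. 140 (2004), §1.3 H.4, Lemma 3.1.1
and Def. 3.2.6 (arXiv:1202.6340 p. 7 L78–82, p. 15–16: the local conditions are everywhere exact orthogonal
complements, propagated from the compact module); B. Mazur, K. Rubin, *Kolyvagin systems*, Mem. AMS 799 (2004),
§1.3; J. S. Milne, *Arithmetic Duality Theorems* (2006), I §0 Prop. 0.19, I Cor. 2.3 / Thm. 2.6 (local duality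
of finitely generated modules by passage to the limit); J.-P. Serre, *Galois Cohomology* (1997), I §2.2.
-/

set_option autoImplicit false

noncomputable section

universe u v w u' v'

namespace Literature.NumberTheory.EllipticCurves

namespace Tower

section Maps

variable {Y : ℕ → Type v} [∀ j, AddCommGroup (Y j)] (red' : ∀ j, Y (j + 1) →+ Y j)
variable {G : ℕ → Type v'} [∀ j, AddCommGroup (G j)] (redG : ∀ j, G (j + 1) →+ G j)

/-! ## §1 Tower maps preserve compatible families; images of compatible families in the cores are saturated -/

/-- **A tower map carries compatible families to compatible families**: for additive maps `π′_j : Y_j → G_j`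
commuting with the reductions (`red_G ∘ π′_{j+1} = π′_j ∘ red′`), the image `(π′_j ζ_j)_j` of a compatible
family `ζ` of `Y` is a compatible family of `G` (functoriality of the inverse limit).
[cite: SerreGaloisCohomology1997, Ch. I §2.2 (inverse limits)] -/
theorem apply_mem_compatibleFamilies_of_commute (π' : ∀ j, Y j →+ G j)
    (hπ : ∀ j (y : Y (j + 1)), redG j (π' (j + 1) y) = π' j (red' j y))
    {ζ : Π j, Y j} (hζ : ζ ∈ compatibleFamilies red') :
    (fun j ↦ π' j (ζ j)) ∈ compatibleFamilies redG := by
  rw [mem_compatibleFamilies_iff]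
  intro j
  rw [hπ, (mem_compatibleFamilies_iff red' ζ).1 hζ j]

variable {X : ℕ → Type u} [∀ j, AddCommGroup (X j)] (red : ∀ j, X (j + 1) →+ X j)
variable {F : ℕ → Type u'} [∀ j, AddCommGroup (F j)] (redF : ∀ j, F (j + 1) →+ F j)

/-- **The image of a compatible family of the sub-tower lies in the saturated families** (exponent `0`): for
tower maps `ι_j : F_j → X_j` commuting with the reductions and landing in the cores (`ι_j (F_j) ⊆ C_j` — in the
application `C_j = im (H¹(K_v, Fil W_j) → H¹(K_v, W_j))` IS that image), `(ι_j ξ′_j)_j` is saturated for `C`.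
[cite: Howard2004HeegnerKolyvagin, Def. 2.1.1 and Def. 3.1.2 (arXiv pp. 5, 15: propagation from the compact module)] -/
theorem apply_mem_saturatedFamilies_of_forall_mem (p : ℕ) (C : ∀ j, AddSubgroup (X j)) (ι : ∀ j, F j →+ X j)
    (hι : ∀ j (f : F (j + 1)), red j (ι (j + 1) f) = ι j (redF j f))
    (hC : ∀ j (f : F j), ι j f ∈ C j)
    {ξ' : Π j, F j} (hξ' : ξ' ∈ compatibleFamilies redF) :
    (fun j ↦ ι j (ξ' j)) ∈ saturatedFamilies red p C := by
  refine (mem_saturatedFamilies_iff red p C _).2 ⟨fun j ↦ ?_, 0, fun j ↦ ?_⟩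
  · rw [hι, (mem_compatibleFamilies_iff redF ξ').1 hξ' j]
  · rw [pow_zero, one_smul]
    exact hC j (ξ' j)

end Maps

section Pair

variable {X : ℕ → Type u} [∀ j, AddCommGroup (X j)] (red : ∀ j, X (j + 1) →+ X j)
variable {Y : ℕ → Type v} [∀ j, AddCommGroup (Y j)] (red' : ∀ j, Y (j + 1) →+ Y j)
variable {Q : ℕ → Type w} [∀ j, AddCommGroup (Q j)] (B : ∀ j, X j →+ Y j →+ Q j)
variable {F : ℕ → Type u'} [∀ j, AddCommGroup (F j)] (redF : ∀ j, F (j + 1) →+ F j)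
variable {G : ℕ → Type v'} [∀ j, AddCommGroup (G j)] (redG : ∀ j, G (j + 1) →+ G j)
variable (P : ∀ j, F j →+ G j →+ Q j) (ι : ∀ j, F j →+ X j) (π' : ∀ j, Y j →+ G j)

/-! ## §2 A family orthogonal to the saturated families has torsion image in the quotient tower -/

/-- **Orthogonal to the saturated families ⇒ the image in the restricted dual tower is killed by `p^c`.**
Towers `X, Y` with level pairings `B_j`, cores `C_j ≤ X_j`; a restricted pair `F, G` with pairings `P_j`, tower
maps `ι_j : F_j → X_j` (into the cores) and `π′_j : Y_j → G_j`, the projection formula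
`B_j (ι f, y) = P_j (f, π′ y)`; and for the pair the inputs of `Tower.pow_smul_eq_zero_of_forall_pairing_eq_zero`:
(Adj′) `ι^Q_d (P_k (red_F^{(d)} w, g)) = P_{k+d} (w, up_G g)`, (Nondeg′) right non-degeneracy of every `P_{k+d}`,
(Ker′) `ker up_G ⊆` bottom condition of `G`, and the exponent bound `p^c` for the torsion compatible families
of `G`.  Then every family `ζ` of `Y` with `B_j (ξ_j, ζ_j) = 0` for all saturated `ξ` and all `j` has
`p^c • (π′_j ζ_j)_j = 0`: the image `ι ξ′` of every compatible family of `F` is saturated, so `π′ ζ` pairs to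
zero with all compatible families of `F`, and the right kernel of the limit of the `P_j` is `p^c`-torsion.
[cite: Howard2004HeegnerKolyvagin, §1.3 H.4 and Def. 3.2.6 (arXiv p. 7 L78–82, p. 16)]
[cite: MilneADT2006, Ch. I Cor. 2.3 (local duality for finitely generated modules, by passage to the limit)] -/
theorem pow_smul_map_eq_zero_of_forall_saturated_pairing_eq_zero [∀ j, Finite (F j)] (p : ℕ)
    (C : ∀ j, AddSubgroup (X j))
    (hι : ∀ j (f : F (j + 1)), red j (ι (j + 1) f) = ι j (redF j f))
    (hC : ∀ j (f : F j), ι j f ∈ C j)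
    (hproj : ∀ j (f : F j) (y : Y j), B j (ι j f) y = P j f (π' j y))
    (upG : ∀ k d : ℕ, G k →+ G (k + d)) (incQ : ∀ k d : ℕ, Q k →+ Q (k + d))
    (hAdj : ∀ (k d : ℕ) (w : F (k + d)) (g : G k),
      incQ k d (P k (redIter redF k d w) g) = P (k + d) w (upG k d g))
    (hNondeg : ∀ (k d : ℕ) (g : G (k + d)), (∀ w : F (k + d), P (k + d) w g = 0) → g = 0)
    (hKer : ∀ (k d : ℕ) (g : G k), upG k d g = 0 →
      g ∈ levelCondition redG p (fun _ ↦ (⊥ : AddSubgroup (G _))) k)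
    {c : ℕ} (hc : ∀ θ ∈ compatibleFamilies redG, (∃ b : ℕ, p ^ b • θ = 0) → p ^ c • θ = 0)
    (ζ : Π j, Y j) (h0 : ∀ (j : ℕ), ∀ ξ ∈ saturatedFamilies red p C, B j (ξ j) (ζ j) = 0) :
    p ^ c • (fun j ↦ π' j (ζ j)) = 0 :=
  pow_smul_eq_zero_of_forall_pairing_eq_zero redF redG P p upG incQ hAdj hNondeg hKer hc (fun j ↦ π' j (ζ j))
    fun k ξ' hξ' ↦ by
      rw [← hproj]
      exact h0 k (fun j ↦ ι j (ξ' j)) (apply_mem_saturatedFamilies_of_forall_mem red redF p C ι hι hC hξ')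

/-- Componentwise form of §2: `π′_j (p^c • ζ_j) = 0` for every `j`.
[cite: Howard2004HeegnerKolyvagin, §1.3 H.4 (arXiv p. 7 L78–82)] [cite: MilneADT2006, Ch. I Cor. 2.3] -/
theorem map_pow_smul_eq_zero_of_forall_saturated_pairing_eq_zero [∀ j, Finite (F j)] (p : ℕ)
    (C : ∀ j, AddSubgroup (X j))
    (hι : ∀ j (f : F (j + 1)), red j (ι (j + 1) f) = ι j (redF j f))
    (hC : ∀ j (f : F j), ι j f ∈ C j)
    (hproj : ∀ j (f : F j) (y : Y j), B j (ι j f) y = P j f (π' j y))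
    (upG : ∀ k d : ℕ, G k →+ G (k + d)) (incQ : ∀ k d : ℕ, Q k →+ Q (k + d))
    (hAdj : ∀ (k d : ℕ) (w : F (k + d)) (g : G k),
      incQ k d (P k (redIter redF k d w) g) = P (k + d) w (upG k d g))
    (hNondeg : ∀ (k d : ℕ) (g : G (k + d)), (∀ w : F (k + d), P (k + d) w g = 0) → g = 0)
    (hKer : ∀ (k d : ℕ) (g : G k), upG k d g = 0 →
      g ∈ levelCondition redG p (fun _ ↦ (⊥ : AddSubgroup (G _))) k)
    {c : ℕ} (hc : ∀ θ ∈ compatibleFamilies redG, (∃ b : ℕ, p ^ b • θ = 0) → p ^ c • θ = 0)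
    (ζ : Π j, Y j) (h0 : ∀ (j : ℕ), ∀ ξ ∈ saturatedFamilies red p C, B j (ξ j) (ζ j) = 0) (j : ℕ) :
    π' j (p ^ c • ζ j) = 0 := by
  have h := congrFun (pow_smul_map_eq_zero_of_forall_saturated_pairing_eq_zero red B redF redG P ι π' p C hι hC
    hproj upG incQ hAdj hNondeg hKer hc ζ h0) j
  rwa [Pi.smul_apply, Pi.zero_apply, ← map_nsmul] at h

/-! ## §3 (ANN-SAT): a compatible family orthogonal to the saturated families is saturated -/

/-- **(ANN-SAT) `Ann_{Y∞}(Sat_X) ⊆ Sat_Y` — a compatible family orthogonal to all saturated families is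
saturated.**  In the setting of §2 suppose moreover `ker π′_j ⊆ C′_j` at every level (in the application: the
strict kernel `ker (H¹(K_v, Tw W_j) → H¹(K_v, Tw W_j ⧸ Fil′))` lies in the transported ordinary core).  Then a
COMPATIBLE family `ζ` of `Y` with `B_j (ξ_j, ζ_j) = 0` for every saturated family `ξ` of `X` and every `j` is a
saturated family of `Y` for the cores `C′` (exponent `c`: `π′_j (p^c ζ_j) = 0`).  This is the annihilator half of
the limit statement (Exact) of `Tower.mem_levelCondition_of_forall_pairing_eq_zero` — «the annihilator of the
saturated ordinary condition in `H¹(K_v, Tw T)` is contained in the saturated ordinary condition» — obtained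
rank-free from finite-level duality for the restricted pair `Fil W_j × (Tw W_j ⧸ Fil′)`.
[cite: Howard2004HeegnerKolyvagin, §1.3 H.4, Lemma 3.1.1 and Def. 3.2.6 (arXiv p. 7 L78–82, p. 15–16)]
[cite: MazurRubinMemoirs2004, §1.3 (exact orthogonal complements under local duality)]
[cite: MilneADT2006, Ch. I Cor. 2.3 and Thm. 2.6] -/
theorem mem_saturatedFamilies_of_forall_saturated_pairing_eq_zero [∀ j, Finite (F j)] (p : ℕ)
    (C : ∀ j, AddSubgroup (X j)) (C' : ∀ j, AddSubgroup (Y j))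
    (hι : ∀ j (f : F (j + 1)), red j (ι (j + 1) f) = ι j (redF j f))
    (hC : ∀ j (f : F j), ι j f ∈ C j)
    (hproj : ∀ j (f : F j) (y : Y j), B j (ι j f) y = P j f (π' j y))
    (hC' : ∀ j (y : Y j), π' j y = 0 → y ∈ C' j)
    (upG : ∀ k d : ℕ, G k →+ G (k + d)) (incQ : ∀ k d : ℕ, Q k →+ Q (k + d))
    (hAdj : ∀ (k d : ℕ) (w : F (k + d)) (g : G k),
      incQ k d (P k (redIter redF k d w) g) = P (k + d) w (upG k d g))
    (hNondeg : ∀ (k d : ℕ) (g : G (k + d)), (∀ w : F (k + d), P (k + d) w g = 0) → g = 0)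
    (hKer : ∀ (k d : ℕ) (g : G k), upG k d g = 0 →
      g ∈ levelCondition redG p (fun _ ↦ (⊥ : AddSubgroup (G _))) k)
    {c : ℕ} (hc : ∀ θ ∈ compatibleFamilies redG, (∃ b : ℕ, p ^ b • θ = 0) → p ^ c • θ = 0)
    {ζ : Π j, Y j} (hζ : ζ ∈ compatibleFamilies red')
    (h0 : ∀ (j : ℕ), ∀ ξ ∈ saturatedFamilies red p C, B j (ξ j) (ζ j) = 0) :
    ζ ∈ saturatedFamilies red' p C' :=
  (mem_saturatedFamilies_iff red' p C' ζ).2 ⟨(mem_compatibleFamilies_iff red' ζ).1 hζ, c, fun j ↦ hC' j _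
    (map_pow_smul_eq_zero_of_forall_saturated_pairing_eq_zero red B redF redG P ι π' p C hι hC hproj upG incQ hAdj
      hNondeg hKer hc ζ h0 j)⟩

/-- **(ANN-SAT), level-condition form**: the same with the orthogonality hypothesis stated on the saturated LEVEL
CONDITIONS, `B_j (x, ζ_j) = 0` for all `x ∈ levelCondition red p C j` and all `j`.
[cite: Howard2004HeegnerKolyvagin, §1.3 H.4 and Def. 3.2.6 (arXiv p. 7 L78–82, p. 16)] [cite: MilneADT2006, Ch. I Cor. 2.3] -/
theorem mem_saturatedFamilies_of_forall_levelCondition_pairing_eq_zero [∀ j, Finite (F j)] (p : ℕ)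
    (C : ∀ j, AddSubgroup (X j)) (C' : ∀ j, AddSubgroup (Y j))
    (hι : ∀ j (f : F (j + 1)), red j (ι (j + 1) f) = ι j (redF j f))
    (hC : ∀ j (f : F j), ι j f ∈ C j)
    (hproj : ∀ j (f : F j) (y : Y j), B j (ι j f) y = P j f (π' j y))
    (hC' : ∀ j (y : Y j), π' j y = 0 → y ∈ C' j)
    (upG : ∀ k d : ℕ, G k →+ G (k + d)) (incQ : ∀ k d : ℕ, Q k →+ Q (k + d))
    (hAdj : ∀ (k d : ℕ) (w : F (k + d)) (g : G k),
      incQ k d (P k (redIter redF k d w) g) = P (k + d) w (upG k d g))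
    (hNondeg : ∀ (k d : ℕ) (g : G (k + d)), (∀ w : F (k + d), P (k + d) w g = 0) → g = 0)
    (hKer : ∀ (k d : ℕ) (g : G k), upG k d g = 0 →
      g ∈ levelCondition redG p (fun _ ↦ (⊥ : AddSubgroup (G _))) k)
    {c : ℕ} (hc : ∀ θ ∈ compatibleFamilies redG, (∃ b : ℕ, p ^ b • θ = 0) → p ^ c • θ = 0)
    {ζ : Π j, Y j} (hζ : ζ ∈ compatibleFamilies red')
    (h0 : ∀ (j : ℕ), ∀ x ∈ levelCondition red p C j, B j x (ζ j) = 0) :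
    ζ ∈ saturatedFamilies red' p C' :=
  mem_saturatedFamilies_of_forall_saturated_pairing_eq_zero red red' B redF redG P ι π' p C C' hι hC hproj hC' upG
    incQ hAdj hNondeg hKer hc hζ fun j ξ hξ ↦ h0 j (ξ j) (apply_mem_levelCondition red p C hξ j)

/-- **(ANN-SAT) restricted to the sub-tower image only.**  The orthogonality hypothesis is only ever used on the
images `ι ξ′` of the compatible families of `F` (the strict cores in the limit, memo §1 (a): `Ann(Sat_X) = Ann(C∞)`):
a compatible `ζ` with `B_j (ι_j ξ′_j, ζ_j) = 0` for all compatible `ξ′` of `F` and all `j` is saturated for `C′`.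
[cite: Howard2004HeegnerKolyvagin, §1.3 H.4 and Def. 3.2.6 (arXiv p. 7 L78–82, p. 16)] [cite: MilneADT2006, Ch. I Cor. 2.3] -/
theorem mem_saturatedFamilies_of_forall_sub_pairing_eq_zero [∀ j, Finite (F j)] (p : ℕ)
    (C' : ∀ j, AddSubgroup (Y j))
    (hproj : ∀ j (f : F j) (y : Y j), B j (ι j f) y = P j f (π' j y))
    (hC' : ∀ j (y : Y j), π' j y = 0 → y ∈ C' j)
    (upG : ∀ k d : ℕ, G k →+ G (k + d)) (incQ : ∀ k d : ℕ, Q k →+ Q (k + d))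
    (hAdj : ∀ (k d : ℕ) (w : F (k + d)) (g : G k),
      incQ k d (P k (redIter redF k d w) g) = P (k + d) w (upG k d g))
    (hNondeg : ∀ (k d : ℕ) (g : G (k + d)), (∀ w : F (k + d), P (k + d) w g = 0) → g = 0)
    (hKer : ∀ (k d : ℕ) (g : G k), upG k d g = 0 →
      g ∈ levelCondition redG p (fun _ ↦ (⊥ : AddSubgroup (G _))) k)
    {c : ℕ} (hc : ∀ θ ∈ compatibleFamilies redG, (∃ b : ℕ, p ^ b • θ = 0) → p ^ c • θ = 0)
    {ζ : Π j, Y j} (hζ : ζ ∈ compatibleFamilies red')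
    (h0 : ∀ (j : ℕ), ∀ ξ' ∈ compatibleFamilies redF, B j (ι j (ξ' j)) (ζ j) = 0) :
    ζ ∈ saturatedFamilies red' p C' := by
  refine (mem_saturatedFamilies_iff red' p C' ζ).2 ⟨(mem_compatibleFamilies_iff red' ζ).1 hζ, c, fun j ↦ hC' j _ ?_⟩
  have h := congrFun (pow_smul_eq_zero_of_forall_pairing_eq_zero redF redG P p upG incQ hAdj hNondeg hKer hc
    (fun j ↦ π' j (ζ j)) fun k ξ' hξ' ↦ by rw [← hproj]; exact h0 k ξ' hξ') j
  rwa [Pi.smul_apply, Pi.zero_apply, ← map_nsmul] at h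

end Pair

/-! ## §4 The (Ker-tors) variants: `ker up_G ⊆ p^c`-torsion replaces (Ker′) + the exponent bound

In the application the dual quotient tower `G_j = H¹(K_v, Tw W_j ⧸ Fil′_j)` is needed only through its up-maps
`up_G : G_k → G_{k+d}` (`H¹` of the divisions `×p^d`), whose kernels are connecting images of the invariants
`H⁰(K_v, Tw W_d ⧸ Fil′_d)`, killed by a uniform `p^c`; so the two inputs (Ker′) «`ker up_G ⊆` bottom condition» and
(hc) «torsion compatible families of `G` are killed by `p^c`» of §§2–3 are traded for the single levelwise input
(Ker-tors) «`up_G y = 0 → p^c • y = 0`», and NO reduction maps of `G` are needed. -/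

section KerTorsion

variable {X : ℕ → Type u} [∀ j, AddCommGroup (X j)] (red : ∀ j, X (j + 1) →+ X j)
variable {Y : ℕ → Type v} [∀ j, AddCommGroup (Y j)]
variable {Q : ℕ → Type w} [∀ j, AddCommGroup (Q j)] (B : ∀ j, X j →+ Y j →+ Q j)

/-- **Orthogonal to the liftable classes ⇒ `p^c`-torsion** (one level; the (Ker-tors) twin of
`Tower.mem_levelCondition_bot_of_forall_pairing_top_eq_zero`): from (Adj′), (Nondeg′) and (Ker-tors)
«`up′_d y = 0 → p^c • y = 0`», a class `y ∈ Y_k` pairing to zero with every LIFTABLE class of `X_k` is killed by `p^c`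
(the liftable classes contain a stable image `red^{(d₀)} (X_{k+d₀})`, so `up′_{d₀} y = 0`).
[cite: MilneADT2006, Ch. I §0 Prop. 0.19 and Cor. 2.3] [cite: Howard2004HeegnerKolyvagin, §1.3 H.4 (arXiv p. 7, L78–82)] -/
theorem pow_smul_eq_zero_of_forall_pairing_top_eq_zero_of_ker_torsion [∀ j, Finite (X j)] (p : ℕ) (k : ℕ)
    (up' : ∀ d : ℕ, Y k →+ Y (k + d)) (incQ : ∀ d : ℕ, Q k →+ Q (k + d))
    (hAdj : ∀ (d : ℕ) (w : X (k + d)) (y : Y k), incQ d (B k (redIter red k d w) y) = B (k + d) w (up' d y))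
    (hNondeg : ∀ (d : ℕ) (y' : Y (k + d)), (∀ w : X (k + d), B (k + d) w y' = 0) → y' = 0)
    {c : ℕ} (hKerT : ∀ (d : ℕ) (y : Y k), up' d y = 0 → p ^ c • y = 0)
    (y : Y k) (hy : ∀ x ∈ levelCondition red p (fun _ ↦ (⊤ : AddSubgroup (X _))) k, B k x y = 0) :
    p ^ c • y = 0 := by
  obtain ⟨d₀, hd₀⟩ := exists_range_redIter_le_levelCondition_top red p k
  refine hKerT d₀ y (hNondeg d₀ (up' d₀ y) fun w ↦ ?_)
  rw [← hAdj, hy _ (hd₀ ⟨w, rfl⟩), map_zero]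

/-- **The right kernel of the limit pairing is `p^c`-torsion, (Ker-tors) form** (the twin of
`Tower.pow_smul_eq_zero_of_forall_pairing_eq_zero` with (Ker′) + (hc) replaced by the levelwise
«`up′_{k,d} y = 0 → p^c • y = 0`»; no reduction maps of `Y` are used): a family `y` of `Y` pairing to zero with every
compatible family of `X` at every level is killed by `p^c`. [cite: MilneADT2006, Ch. I Cor. 2.3]
[cite: SerreGaloisCohomology1997, Ch. I §2.2] -/
theorem pow_smul_eq_zero_of_forall_pairing_eq_zero_of_ker_torsion [∀ j, Finite (X j)] (p : ℕ)
    (up' : ∀ k d : ℕ, Y k →+ Y (k + d)) (incQ : ∀ k d : ℕ, Q k →+ Q (k + d))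
    (hAdj : ∀ (k d : ℕ) (w : X (k + d)) (y : Y k),
      incQ k d (B k (redIter red k d w) y) = B (k + d) w (up' k d y))
    (hNondeg : ∀ (k d : ℕ) (y' : Y (k + d)), (∀ w : X (k + d), B (k + d) w y' = 0) → y' = 0)
    {c : ℕ} (hKerT : ∀ (k d : ℕ) (y : Y k), up' k d y = 0 → p ^ c • y = 0)
    (y : Π j, Y j) (h0 : ∀ (k : ℕ), ∀ x ∈ compatibleFamilies red, B k (x k) (y k) = 0) :
    p ^ c • y = 0 := by
  funext k
  rw [Pi.smul_apply, Pi.zero_apply]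
  exact pow_smul_eq_zero_of_forall_pairing_top_eq_zero_of_ker_torsion red B p k (up' k) (incQ k) (hAdj k)
    (hNondeg k) (hKerT k) (y k) fun x hx ↦ by
      obtain ⟨ξ, hξ, rfl⟩ := (mem_levelCondition_top_iff red p k x).1 hx
      exact h0 k ξ hξ

variable (red' : ∀ j, Y (j + 1) →+ Y j)
variable {F : ℕ → Type u'} [∀ j, AddCommGroup (F j)] (redF : ∀ j, F (j + 1) →+ F j)
variable {G : ℕ → Type v'} [∀ j, AddCommGroup (G j)]
variable (P : ∀ j, F j →+ G j →+ Q j) (ι : ∀ j, F j →+ X j) (π' : ∀ j, Y j →+ G j)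

/-- **§2 in (Ker-tors) form**: a family `ζ` of `Y` orthogonal to all saturated families of `X` at every level has
`p^c • (π′_j ζ_j)_j = 0`, from (proj), (core), and for the pair `(F, G, P)`: (Adj′), (Nondeg′) and (Ker-tors)
«`up_G y = 0 → p^c • y = 0`» (no reductions of `G`). [cite: Howard2004HeegnerKolyvagin, §1.3 H.4 and Def. 3.2.6 (arXiv p. 7 L78–82, p. 16)]
[cite: MilneADT2006, Ch. I Cor. 2.3] -/
theorem pow_smul_map_eq_zero_of_forall_saturated_pairing_eq_zero_of_ker_torsion [∀ j, Finite (F j)] (p : ℕ)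
    (C : ∀ j, AddSubgroup (X j))
    (hι : ∀ j (f : F (j + 1)), red j (ι (j + 1) f) = ι j (redF j f))
    (hC : ∀ j (f : F j), ι j f ∈ C j)
    (hproj : ∀ j (f : F j) (y : Y j), B j (ι j f) y = P j f (π' j y))
    (upG : ∀ k d : ℕ, G k →+ G (k + d)) (incQ : ∀ k d : ℕ, Q k →+ Q (k + d))
    (hAdj : ∀ (k d : ℕ) (w : F (k + d)) (g : G k),
      incQ k d (P k (redIter redF k d w) g) = P (k + d) w (upG k d g))
    (hNondeg : ∀ (k d : ℕ) (g : G (k + d)), (∀ w : F (k + d), P (k + d) w g = 0) → g = 0)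
    {c : ℕ} (hKerT : ∀ (k d : ℕ) (g : G k), upG k d g = 0 → p ^ c • g = 0)
    (ζ : Π j, Y j) (h0 : ∀ (j : ℕ), ∀ ξ ∈ saturatedFamilies red p C, B j (ξ j) (ζ j) = 0) :
    p ^ c • (fun j ↦ π' j (ζ j)) = 0 :=
  pow_smul_eq_zero_of_forall_pairing_eq_zero_of_ker_torsion redF P p upG incQ hAdj hNondeg hKerT
    (fun j ↦ π' j (ζ j)) fun k ξ' hξ' ↦ by
      rw [← hproj]
      exact h0 k (fun j ↦ ι j (ξ' j)) (apply_mem_saturatedFamilies_of_forall_mem red redF p C ι hι hC hξ')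

/-- **(ANN-SAT), (Ker-tors) form — `Ann_{Y∞}(Sat_X) ⊆ Sat_Y`.**  Towers `X, Y` with level pairings `B_j`, cores
`C_j ≤ X_j`, `C′_j ≤ Y_j`; a restricted pair: a tower `F` (reductions `red_F`, finite levels) with pairings
`P_j : F_j × G_j → Q_j` into groups `G_j`, tower maps `ι_j : F_j → X_j` into the cores and additive `π′_j : Y_j → G_j`
with `ker π′_j ⊆ C′_j`, the projection formula `B_j (ι f, y) = P_j (f, π′ y)`, and for the pair: (Adj′)
`ι^Q (P_k (red_F^{(d)} w, g)) = P_{k+d} (w, up_G g)`, right non-degeneracy of every `P_{k+d}`, and (Ker-tors)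
`up_G g = 0 → p^c • g = 0`.  Then every COMPATIBLE family `ζ` of `Y` with `B_j (ξ_j, ζ_j) = 0` for all saturated `ξ`
and all `j` is saturated for `C′`, with exponent `c`.  (In the application: `G_j = H¹(K_v, Tw W_j ⧸ Fil′_j)`, `up_G =
H¹(×p^d)`, whose kernel is the connecting image of `H⁰(K_v, Tw W_d ⧸ Fil′_d)`, killed by `p`.)
[cite: Howard2004HeegnerKolyvagin, §1.3 H.4, Lemma 3.1.1 and Def. 3.2.6 (arXiv p. 7 L78–82, p. 15–16)]
[cite: MazurRubinMemoirs2004, §1.3] [cite: MilneADT2006, Ch. I Cor. 2.3 and Thm. 2.6] -/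
theorem mem_saturatedFamilies_of_forall_saturated_pairing_eq_zero_of_ker_torsion [∀ j, Finite (F j)] (p : ℕ)
    (C : ∀ j, AddSubgroup (X j)) (C' : ∀ j, AddSubgroup (Y j))
    (hι : ∀ j (f : F (j + 1)), red j (ι (j + 1) f) = ι j (redF j f))
    (hC : ∀ j (f : F j), ι j f ∈ C j)
    (hproj : ∀ j (f : F j) (y : Y j), B j (ι j f) y = P j f (π' j y))
    (hC' : ∀ j (y : Y j), π' j y = 0 → y ∈ C' j)
    (upG : ∀ k d : ℕ, G k →+ G (k + d)) (incQ : ∀ k d : ℕ, Q k →+ Q (k + d))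
    (hAdj : ∀ (k d : ℕ) (w : F (k + d)) (g : G k),
      incQ k d (P k (redIter redF k d w) g) = P (k + d) w (upG k d g))
    (hNondeg : ∀ (k d : ℕ) (g : G (k + d)), (∀ w : F (k + d), P (k + d) w g = 0) → g = 0)
    {c : ℕ} (hKerT : ∀ (k d : ℕ) (g : G k), upG k d g = 0 → p ^ c • g = 0)
    {ζ : Π j, Y j} (hζ : ζ ∈ compatibleFamilies red')
    (h0 : ∀ (j : ℕ), ∀ ξ ∈ saturatedFamilies red p C, B j (ξ j) (ζ j) = 0) :
    ζ ∈ saturatedFamilies red' p C' := by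
  refine (mem_saturatedFamilies_iff red' p C' ζ).2 ⟨(mem_compatibleFamilies_iff red' ζ).1 hζ, c, fun j ↦ hC' j _ ?_⟩
  have h := congrFun (pow_smul_map_eq_zero_of_forall_saturated_pairing_eq_zero_of_ker_torsion red B redF P ι π' p C
    hι hC hproj upG incQ hAdj hNondeg hKerT ζ h0) j
  rwa [Pi.smul_apply, Pi.zero_apply, ← map_nsmul] at h

/-- **(ANN-SAT), (Ker-tors) form, level-condition hypothesis**: the same with orthogonality stated on the saturated
level conditions `levelCondition red p C j`. [cite: Howard2004HeegnerKolyvagin, §1.3 H.4 and Def. 3.2.6 (arXiv p. 7 L78–82, p. 16)]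
[cite: MilneADT2006, Ch. I Cor. 2.3] -/
theorem mem_saturatedFamilies_of_forall_levelCondition_pairing_eq_zero_of_ker_torsion [∀ j, Finite (F j)] (p : ℕ)
    (C : ∀ j, AddSubgroup (X j)) (C' : ∀ j, AddSubgroup (Y j))
    (hι : ∀ j (f : F (j + 1)), red j (ι (j + 1) f) = ι j (redF j f))
    (hC : ∀ j (f : F j), ι j f ∈ C j)
    (hproj : ∀ j (f : F j) (y : Y j), B j (ι j f) y = P j f (π' j y))
    (hC' : ∀ j (y : Y j), π' j y = 0 → y ∈ C' j)
    (upG : ∀ k d : ℕ, G k →+ G (k + d)) (incQ : ∀ k d : ℕ, Q k →+ Q (k + d))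
    (hAdj : ∀ (k d : ℕ) (w : F (k + d)) (g : G k),
      incQ k d (P k (redIter redF k d w) g) = P (k + d) w (upG k d g))
    (hNondeg : ∀ (k d : ℕ) (g : G (k + d)), (∀ w : F (k + d), P (k + d) w g = 0) → g = 0)
    {c : ℕ} (hKerT : ∀ (k d : ℕ) (g : G k), upG k d g = 0 → p ^ c • g = 0)
    {ζ : Π j, Y j} (hζ : ζ ∈ compatibleFamilies red')
    (h0 : ∀ (j : ℕ), ∀ x ∈ levelCondition red p C j, B j x (ζ j) = 0) :
    ζ ∈ saturatedFamilies red' p C' :=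
  mem_saturatedFamilies_of_forall_saturated_pairing_eq_zero_of_ker_torsion red B red' redF P ι π' p C C' hι hC hproj
    hC' upG incQ hAdj hNondeg hKerT hζ fun j ξ hξ ↦ h0 j (ξ j) (apply_mem_levelCondition red p C hξ j)

/-- **(ANN-SAT), (Ker-tors) form, sub-tower hypothesis only** (memo §1 (a): `Ann(Sat_X) = Ann(C∞)`): orthogonality
is only needed on the images `ι ξ′` of the compatible families of `F`.
[cite: Howard2004HeegnerKolyvagin, §1.3 H.4 and Def. 3.2.6 (arXiv p. 7 L78–82, p. 16)] [cite: MilneADT2006, Ch. I Cor. 2.3] -/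
theorem mem_saturatedFamilies_of_forall_sub_pairing_eq_zero_of_ker_torsion [∀ j, Finite (F j)] (p : ℕ)
    (C' : ∀ j, AddSubgroup (Y j))
    (hproj : ∀ j (f : F j) (y : Y j), B j (ι j f) y = P j f (π' j y))
    (hC' : ∀ j (y : Y j), π' j y = 0 → y ∈ C' j)
    (upG : ∀ k d : ℕ, G k →+ G (k + d)) (incQ : ∀ k d : ℕ, Q k →+ Q (k + d))
    (hAdj : ∀ (k d : ℕ) (w : F (k + d)) (g : G k),
      incQ k d (P k (redIter redF k d w) g) = P (k + d) w (upG k d g))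
    (hNondeg : ∀ (k d : ℕ) (g : G (k + d)), (∀ w : F (k + d), P (k + d) w g = 0) → g = 0)
    {c : ℕ} (hKerT : ∀ (k d : ℕ) (g : G k), upG k d g = 0 → p ^ c • g = 0)
    {ζ : Π j, Y j} (hζ : ζ ∈ compatibleFamilies red')
    (h0 : ∀ (j : ℕ), ∀ ξ' ∈ compatibleFamilies redF, B j (ι j (ξ' j)) (ζ j) = 0) :
    ζ ∈ saturatedFamilies red' p C' := by
  refine (mem_saturatedFamilies_iff red' p C' ζ).2 ⟨(mem_compatibleFamilies_iff red' ζ).1 hζ, c, fun j ↦ hC' j _ ?_⟩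
  have h := congrFun (pow_smul_eq_zero_of_forall_pairing_eq_zero_of_ker_torsion redF P p upG incQ hAdj hNondeg hKerT
    (fun j ↦ π' j (ζ j)) fun k ξ' hξ' ↦ by rw [← hproj]; exact h0 k ξ' hξ') j
  rwa [Pi.smul_apply, Pi.zero_apply, ← map_nsmul] at h

end KerTorsion

end Tower

end Literature.NumberTheory.EllipticCurves

end
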